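import Summits.AtomisticToContinuum.Crystallization.Theorems.ThreeConeCertificateSlackRigidityRooting
import Mathlib.MeasureTheory.Measure.Haar.InnerProductSpace
import Mathlib.MeasureTheory.Group.Integral
import Mathlib.MeasureTheory.Integral.Bochner.Set
import HarnessLib

/-!
# Line `signed-root-silent-field` for crux `SlackRigidity` (stmt-AtomisticToContinuum-11960):
# rooting with the field channel, part A — the smeared field of one configuration

Helper lemmas for the registered stub `stub_rootingField` (file
`ThreeConeCertificateSlackRigidityRootingField.lean`), which is the landed c-layer rooting theorem
`CLayerWitnessRooting.stub_rooting` with the positive-type hypothesis on `f` replaced by the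
SMEARING representation `f(|u − v|) = ∫ K(|y − u|) K(|y − v|) dy` and one more channel, the local
`L²`-mass of the smeared field `Φ_z(w) = Σ_j K(|w − z_j|)` of a configuration `z`:

* `sum_sum_eq_integral_field_sq` — smearing identity with unit weights,
  `Σ_i Σ_j f(|z_i − z_j|) = ∫ Φ_z²`; `integrable_field_sq` — `Φ_z²` is integrable;
* `sum_star_add_interactionEnergy_add_field_le` — three-channel TOTAL SLACK: with the split
  `V_LJ = g + U + f` on `(0,∞)` and a star functional `F` certifying
  `Σ_i F(star_i) ≤ Σ_{i<j} g + cM`, `Σ_i F(star_i) + Σ_{i<j} U + ½ ∫Φ_z² ≤ 𝓔_LJ(z) + (c + f(0)/2)·M`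
  (same right-hand side as the c-layer's `sum_star_add_interactionEnergy_le`; uses
  `2 Σ_{i<j} f = Σ_i Σ_j f − M f(0)`);
* `sum_setIntegral_closedBall_le` (anchor) — DOUBLE COUNTING for the field channel on a
  `1/3`-separated configuration: `Σ_i ∫_{B(z_i,L)} Ψ ≤ (6L+1)³ ∫ Ψ` for `Ψ ≥ 0` integrable, by the
  packing count `card_filter_dist_le` at every point;
* `exists_bad_localSlack_field_le` — Markov on the sum of the two local weights: among more than
  `(6L+1)³ (2·slack + ∫Φ_z²)/η` bad particles one has `L`-local `(F,U)`-slack `≤ η` AND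
  `∫_{B(z_i,L)} Φ_z² ≤ η`;
* `tsum_image_sub_range`, `setIntegral_closedBall_zero_comp_add`, `le_and_one_div_le_of_max_ceil_le`
  — the field of the recentred finite set is a finite sum, translation of the ball, the diagonal
  threshold.

All elementary ([folklore]); inputs: `CLayerWitnessRooting.*` (RootingSlack), Mathlib's
`integral_finsetSum`, `integral_indicator`, `integral_add_right_eq_self`.
-/

noncomputable section

open scoped BigOperators Topology
open MeasureTheory Filter Set Metric
open Literature.MathematicalPhysics.StatisticalMechanics
open Summit.AtomisticToContinuum.Crystallization.Theorems.SlackRigidityNegative (E3 Good)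
open Summit.AtomisticToContinuum.Crystallization.Theorems.CLayerWitnessRooting

namespace Summit.AtomisticToContinuum.Crystallization.Theorems.SignedRootRooting

/-! ## The smeared field of one configuration -/

section OneConfig

variable {M : ℕ}

/-- **Smearing identity with unit weights.** For `f(|u − v|) = ∫ K(|y−u|) K(|y−v|) dy`,
`Σᵢ Σⱼ f(|zᵢ − zⱼ|) = ∫ Φ_z²` with `Φ_z(w) = Σⱼ K(|w − zⱼ|)`. [folklore] -/
theorem sum_sum_eq_integral_field_sq {f K : ℝ → ℝ}
    (hint : ∀ u v : E3, Integrable (fun y : E3 => K ‖y - u‖ * K ‖y - v‖))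
    (hfK : ∀ u v : E3, f (dist u v) = ∫ y : E3, K ‖y - u‖ * K ‖y - v‖) (z : Fin M → E3) :
    ∑ i, ∑ j, f (dist (z i) (z j)) = ∫ w : E3, (∑ j, K ‖w - z j‖) ^ 2 := by
  symm
  calc ∫ w : E3, (∑ j, K ‖w - z j‖) ^ 2
      = ∫ w : E3, ∑ i, ∑ j, K ‖w - z i‖ * K ‖w - z j‖ := by
        congr 1
        funext w
        rw [sq, Finset.sum_mul_sum]
    _ = ∑ i, ∫ w : E3, ∑ j, K ‖w - z i‖ * K ‖w - z j‖ := by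
        rw [integral_finsetSum]
        exact fun i _ => integrable_finsetSum _ fun j _ => hint (z i) (z j)
    _ = ∑ i, ∑ j, ∫ w : E3, K ‖w - z i‖ * K ‖w - z j‖ := by
        refine Finset.sum_congr rfl fun i _ => ?_
        rw [integral_finsetSum]
        exact fun j _ => hint (z i) (z j)
    _ = ∑ i, ∑ j, f (dist (z i) (z j)) := by
        refine Finset.sum_congr rfl fun i _ => Finset.sum_congr rfl fun j _ => ?_
        rw [hfK (z i) (z j)]

/-- The squared field `Φ_z²` is integrable (a finite double sum of the integrable products).
[folklore] -/
theorem integrable_field_sq {K : ℝ → ℝ}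
    (hint : ∀ u v : E3, Integrable (fun y : E3 => K ‖y - u‖ * K ‖y - v‖)) (z : Fin M → E3) :
    Integrable (fun w : E3 => (∑ j, K ‖w - z j‖) ^ 2) := by
  have h : (fun w : E3 => (∑ j, K ‖w - z j‖) ^ 2) =
      fun w => ∑ i, ∑ j, K ‖w - z i‖ * K ‖w - z j‖ := by
    funext w
    rw [sq, Finset.sum_mul_sum]
  rw [h]
  exact integrable_finsetSum _ fun i _ => integrable_finsetSum _ fun j _ => hint (z i) (z j)

/-- **Total slack with the field channel.** For an injective `z`, a split `V_LJ = g + U + f` on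
`(0,∞)`, the smearing representation of `f` and a star functional with
`Σ_i F(star_i) ≤ Σ_{i<j} g + cM` on injective configurations:
`Σ_i F(star_i) + Σ_{i<j} U + ½ ∫Φ_z² ≤ 𝓔_LJ(z) + (c + f(0)/2)·M`
(use `2 Σ_{i<j} f = Σ_i Σ_j f − M f(0) = ∫Φ_z² − M f(0)`). [folklore] -/
theorem sum_star_add_interactionEnergy_add_field_le {c ρ' : ℝ} {g U f K : ℝ → ℝ}
    {F : Set E3 → ℝ}
    (hsplit : ∀ r : ℝ, 0 < r → lennardJones r = g r + U r + f r)
    (hint : ∀ u v : E3, Integrable (fun y : E3 => K ‖y - u‖ * K ‖y - v‖))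
    (hfK : ∀ u v : E3, f (dist u v) = ∫ y : E3, K ‖y - u‖ * K ‖y - v‖)
    (hstar : ∀ (N : ℕ) (x : Fin N → E3), Function.Injective x →
      ∑ i, F (((fun z => z - x i) '' Set.range x) ∩ Metric.closedBall 0 ρ') ≤
        interactionEnergy g x + c * N)
    {z : Fin M → E3} (hz : Function.Injective z) :
    ∑ i, F (((fun w => w - z i) '' Set.range z) ∩ Metric.closedBall 0 ρ') +
        interactionEnergy U z + 1 / 2 * ∫ w : E3, (∑ j, K ‖w - z j‖) ^ 2 ≤
      interactionEnergy lennardJones z + (c + f 0 / 2) * M := by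
  have h1 := interactionEnergy_lennardJones_split hsplit hz
  have h2 := two_mul_interactionEnergy_eq_sum_sum_sub f z
  have h3 := sum_sum_eq_integral_field_sq hint hfK z
  have h4 := hstar M z hz
  rw [h3] at h2
  linarith

/-- **Double counting for the field channel.** On a `1/3`-separated configuration, for a
nonnegative integrable density `Ψ`, `Σ_i ∫_{B(z_i, L)} Ψ ≤ (6L+1)³ ∫ Ψ`: pointwise, the number of
balls `B(z_i, L)` containing `w` is the packing count `card_filter_dist_le` at `w` (anchor
theorem of this helper file). [folklore] -/
theorem sum_setIntegral_closedBall_le :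
    ∀ {M : ℕ} {z : Fin M → E3}, (∀ i j : Fin M, i ≠ j → (1 / 3 : ℝ) ≤ dist (z i) (z j)) →
    ∀ {L : ℝ}, 0 ≤ L → ∀ {Ψ : E3 → ℝ}, Integrable Ψ → (∀ w, 0 ≤ Ψ w) →
    ∑ i, ∫ w in Metric.closedBall (z i) L, Ψ w ≤ (6 * L + 1) ^ 3 * ∫ w, Ψ w := by
  intro M z hsep L hL Ψ hΨ hΨ0
  classical
  have hmeas : ∀ i : Fin M, MeasurableSet (Metric.closedBall (z i) L) := fun i =>
    measurableSet_closedBall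
  have hind : ∀ i : Fin M, Integrable ((Metric.closedBall (z i) L).indicator Ψ) := fun i =>
    hΨ.indicator (hmeas i)
  have hpt : ∀ w : E3, ∑ i, (Metric.closedBall (z i) L).indicator Ψ w ≤ (6 * L + 1) ^ 3 * Ψ w := by
    intro w
    calc ∑ i, (Metric.closedBall (z i) L).indicator Ψ w
        = ∑ i, if dist (z i) w ≤ L then Ψ w else 0 := by
          refine Finset.sum_congr rfl fun i _ => ?_
          by_cases h : dist (z i) w ≤ L
          · rw [if_pos h, Set.indicator_of_mem (Metric.mem_closedBall'.2 h)]
          · rw [if_neg h, Set.indicator_of_notMem (fun h' => h (Metric.mem_closedBall'.1 h'))]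
      _ = ((Finset.univ.filter fun i => dist (z i) w ≤ L).card : ℝ) * Ψ w := by
          rw [← Finset.sum_filter, Finset.sum_const, nsmul_eq_mul]
      _ ≤ (6 * L + 1) ^ 3 * Ψ w :=
          mul_le_mul_of_nonneg_right (card_filter_dist_le hsep hL w) (hΨ0 w)
  calc ∑ i, ∫ w in Metric.closedBall (z i) L, Ψ w
      = ∑ i, ∫ w, (Metric.closedBall (z i) L).indicator Ψ w := by
        refine Finset.sum_congr rfl fun i _ => ?_
        rw [integral_indicator (hmeas i)]
    _ = ∫ w, ∑ i, (Metric.closedBall (z i) L).indicator Ψ w := by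
        rw [integral_finsetSum]
        exact fun i _ => hind i
    _ ≤ ∫ w, (6 * L + 1) ^ 3 * Ψ w :=
        integral_mono (integrable_finsetSum _ fun i _ => hind i) (hΨ.const_mul _) hpt
    _ = (6 * L + 1) ^ 3 * ∫ w, Ψ w := integral_const_mul _ _

/-- **A bad particle of small local slack in both channels.** On a `1/3`-separated configuration,
if the number of bad particles exceeds `(6L+1)³ (2·slack + ∫Φ_z²) / η`, some bad particle has
`L`-local `(F, U)`-slack `≤ η` AND local field mass `∫_{B(z_i,L)} Φ_z² ≤ η` (double counting in
both channels, Markov `card_filter_mul_le_sum` on the sum of the two local weights). [folklore] -/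
theorem exists_bad_localSlack_field_le (P : PeriodicConfiguration 3) (R ε : ℝ) {ρ' : ℝ}
    {U K : ℝ → ℝ} {F : Set E3 → ℝ} {z : Fin M → E3}
    (hU0 : ∀ r : ℝ, 0 < r → 0 ≤ U r) (hF0 : ∀ T : Set E3, 0 ≤ F T)
    (hint : ∀ u v : E3, Integrable (fun y : E3 => K ‖y - u‖ * K ‖y - v‖))
    (hsep : ∀ i j : Fin M, i ≠ j → (1 / 3 : ℝ) ≤ dist (z i) (z j)) {L η : ℝ} (hL : 0 ≤ L)
    (hη : 0 < η)
    (hcount : (6 * L + 1) ^ 3 * (2 * (∑ j, F (((fun w => w - z j) '' Set.range z) ∩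
        Metric.closedBall 0 ρ') + interactionEnergy U z) +
        ∫ w : E3, (∑ j, K ‖w - z j‖) ^ 2) / η <
      Nat.card {i : Fin M // ¬ Good P R ε z i}) :
    ∃ i : Fin M, ¬ Good P R ε z i ∧
      ∑ j' ∈ Finset.univ.filter (fun j' => dist (z j') (z i) ≤ L),
        (F (((fun w => w - z j') '' Set.range z) ∩ Metric.closedBall 0 ρ') +
          siteEnergy U z j') ≤ η ∧
      ∫ w in Metric.closedBall (z i) L, (∑ j, K ‖w - z j‖) ^ 2 ≤ η := by
  classical
  have hz : Function.Injective z := injective_of_separated (by norm_num) hsep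
  set C : ℝ := (6 * L + 1) ^ 3 with hC
  set Sl : ℝ := ∑ j, F (((fun w => w - z j) '' Set.range z) ∩ Metric.closedBall 0 ρ') +
    interactionEnergy U z with hSl
  set Fi : ℝ := ∫ w : E3, (∑ j, K ‖w - z j‖) ^ 2 with hFi
  set τ : Fin M → ℝ := fun j' => F (((fun w => w - z j') '' Set.range z) ∩
    Metric.closedBall 0 ρ') + siteEnergy U z j' with hτ
  set σ : Fin M → ℝ := fun i => ∑ j' ∈ Finset.univ.filter (fun j' => dist (z j') (z i) ≤ L), τ j'
    with hσ
  set φ : Fin M → ℝ := fun i => ∫ w in Metric.closedBall (z i) L, (∑ j, K ‖w - z j‖) ^ 2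
    with hφ
  have hτ0 : ∀ j', 0 ≤ τ j' := fun j' => siteWeight_nonneg hU0 hF0 hz j'
  have hσ0 : ∀ i, 0 ≤ σ i := fun i => Finset.sum_nonneg fun j' _ => hτ0 j'
  have hφ0 : ∀ i, 0 ≤ φ i := fun i => integral_nonneg fun w => sq_nonneg _
  have hψ0 : ∀ i, 0 ≤ σ i + φ i := fun i => add_nonneg (hσ0 i) (hφ0 i)
  -- Markov + double counting in both channels
  have h1 : η * ((Finset.univ.filter fun i => η < σ i + φ i).card : ℝ) ≤ ∑ i, (σ i + φ i) :=
    card_filter_mul_le_sum hψ0 η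
  have h2 : ∑ i, σ i ≤ C * ∑ j', τ j' := sum_sum_filter_le_mul_sum hsep hτ0 hL
  have h3 : ∑ j', τ j' ≤ 2 * Sl := sum_siteWeight_le hF0
  have h2' : ∑ i, φ i ≤ C * Fi :=
    sum_setIntegral_closedBall_le hsep hL (integrable_field_sq hint z) fun w => sq_nonneg _
  have hC0 : 0 ≤ C := by positivity
  have h4 : ((Finset.univ.filter fun i => η < σ i + φ i).card : ℝ) ≤ C * (2 * Sl + Fi) / η := by
    rw [le_div_iff₀ hη, mul_comm]
    have h5 : ∑ i, (σ i + φ i) = ∑ i, σ i + ∑ i, φ i := Finset.sum_add_distrib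
    have h6 : C * ∑ j', τ j' ≤ C * (2 * Sl) := mul_le_mul_of_nonneg_left h3 hC0
    linarith
  have h5 : ((Finset.univ.filter fun i => η < σ i + φ i).card : ℝ) <
      ((Finset.univ.filter fun i => ¬ Good P R ε z i).card : ℝ) := by
    have e : Nat.card {i : Fin M // ¬ Good P R ε z i} =
        (Finset.univ.filter fun i => ¬ Good P R ε z i).card := by
      rw [Nat.card_eq_fintype_card, Fintype.card_subtype]
    rw [e] at hcount
    exact h4.trans_lt hcount
  have h6 : ¬ (Finset.univ.filter fun i => ¬ Good P R ε z i) ⊆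
      (Finset.univ.filter fun i => η < σ i + φ i) := fun hsub =>
    (Nat.cast_lt.1 h5).not_ge (Finset.card_le_card hsub)
  obtain ⟨i, hi, hi'⟩ := Finset.not_subset.1 h6
  have hle : σ i + φ i ≤ η :=
    not_lt.1 fun h => hi' (Finset.mem_filter.2 ⟨Finset.mem_univ _, h⟩)
  exact ⟨i, (Finset.mem_filter.1 hi).2, by linarith [hφ0 i], by linarith [hσ0 i]⟩

/-- The field of the recentred finite set is a finite sum:
`Σ'_{q ∈ (· − z_i) '' range z} h(q) = Σ_j h(z_j − z_i)` for injective `z`. [folklore] -/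
theorem tsum_image_sub_range {z : Fin M → E3} (hz : Function.Injective z) (i : Fin M)
    (h : E3 → ℝ) :
    ∑' q : ↥((fun w => w - z i) '' Set.range z), h q = ∑ j, h (z j - z i) := by
  rw [tsum_image h sub_left_injective.injOn, tsum_range (fun w => h (w - z i)) hz, tsum_fintype]

end OneConfig

/-- Translating the ball: `∫_{B(0,L)} Ψ(y + v) dy = ∫_{B(v,L)} Ψ` (translation invariance of
Lebesgue measure). [folklore] -/
theorem setIntegral_closedBall_zero_comp_add (Ψ : E3 → ℝ) (v : E3) (L : ℝ) :
    ∫ y in Metric.closedBall (0 : E3) L, Ψ (y + v) = ∫ w in Metric.closedBall v L, Ψ w := by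
  rw [← integral_indicator measurableSet_closedBall, ← integral_indicator measurableSet_closedBall]
  have h : (Metric.closedBall (0 : E3) L).indicator (fun y => Ψ (y + v)) =
      fun y => (Metric.closedBall v L).indicator Ψ (y + v) := by
    funext y
    by_cases hy : y ∈ Metric.closedBall (0 : E3) L
    · have hy' : y + v ∈ Metric.closedBall v L := by
        rw [Metric.mem_closedBall, dist_eq_norm, add_sub_cancel_right]
        rwa [Metric.mem_closedBall, dist_zero_right] at hy
      rw [Set.indicator_of_mem hy, Set.indicator_of_mem hy']
    · have hy' : y + v ∉ Metric.closedBall v L := by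
        rw [Metric.mem_closedBall, dist_eq_norm, add_sub_cancel_right]
        rwa [Metric.mem_closedBall, dist_zero_right] at hy
      rw [Set.indicator_of_notMem hy, Set.indicator_of_notMem hy']
  rw [h]
  exact integral_add_right_eq_self (μ := volume) (fun w => (Metric.closedBall v L).indicator Ψ w) v

/-- The diagonal threshold: for `k ≥ max ⌈L⌉₊ ⌈1/η⌉₊`, `L ≤ k` and `1/(k+1) ≤ η`. [folklore] -/
theorem le_and_one_div_le_of_max_ceil_le {L η : ℝ} (hη : 0 < η) {k : ℕ}
    (hk : max ⌈L⌉₊ ⌈1 / η⌉₊ ≤ k) : L ≤ (k : ℝ) ∧ 1 / ((k : ℝ) + 1) ≤ η := by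
  refine ⟨(Nat.le_ceil L).trans (by exact_mod_cast (le_max_left _ _).trans hk), ?_⟩
  have h1 : 1 / η ≤ (k : ℝ) := (Nat.le_ceil (1 / η)).trans
    (by exact_mod_cast (le_max_right _ _).trans hk)
  rw [div_le_iff₀ (by positivity)]
  rw [div_le_iff₀ hη] at h1
  nlinarith


end Summit.AtomisticToContinuum.Crystallization.Theorems.SignedRootRooting

end
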